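import Literature.NumberTheory.EllipticCurves.PadicLogOfEvalNormedAlgebraProofs
import Literature.NumberTheory.EllipticCurves.SigmaSqNormThroughInvXProofs
import Literature.NumberTheory.EllipticCurves.CanonicalPAdicHeightSqExistenceProofs
import Literature.NumberTheory.LocalFields.PadicComplexIwasawaLogarithm
import Mathlib.RingTheory.Norm.Transitivity
import HarnessLib

/-!
# The `p`-part of the canonical cyclotomic height over a number field, read in `ℂ_p`:
# `ι(Σ_{w∣p} log_p N_{H_w/ℚ_p} Σ_p(z)) = Σ_σ Log Σ_p(σ z)` (proofs only)

Topic `Literature/NumberTheory/EllipticCurves` (trunk T-NT-EC); PROOFS file (theorems only). The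
`p`-part `sigmaSqNormLog W p H z = 2·log_p N_{H/ℚ}(z) + Σ'ₙ [tⁿ]ℒ_p · Tr_{H/ℚ}(zⁿ)` of the canonical
cyclotomic `p`-adic height over a number field `H` (`CanonicalPAdicHeightCyc.lean`, written inside
`ℚ_p` with the RATIONAL numbers `N_{H/ℚ}(z)`, `Tr_{H/ℚ}(zⁿ)` — «DERIVATION: over `ℚ̄_p`,
`log_p Σ_p(τz) = 2 log_p τz + ℒ(τz)` for each of the `[H:ℚ]` embeddings `τ`») is identified, after the
embedding `ι : ℚ_p → L` into an algebraically closed complete ultrametric normed `ℚ_p`-algebra field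
(`L = ℂ_p`), with the SUM OVER THE EMBEDDINGS `σ : H → L` of `Log Σ_p(σ z)`, `Log` the Iwasawa
logarithm of `L` (any function with Robert's three properties V.4.5) and `Σ_p(σ z)` the value
`padicAlgEval L Σ_p (σ z)`. Ingredients: `N = ∏_σ σ`, `Tr = Σ_σ σ` (Mathlib
`Algebra.norm_eq_prod_embeddings`, `trace_eq_sum_embeddings`), `Log ∘ ι = ι ∘ log_p`
(`log_algebraMap_padic`), and `Log(S(u)) = Σₙ ι([tⁿ]ℒ_p) uⁿ` for `S = Σ_p/t²`
(`PadicLogOfEvalNormedAlgebraProofs`). Brick A4 of the existence of the canonical cyclotomic height.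

## Results

* `log_algebraMap_padic` — `Log (ι a) = ι (log_p a)` for `a ∈ ℚ_p^×` (both are Iwasawa logarithms).
* `logFun_prod` — `Log (∏ aᵢ) = Σ Log aᵢ`.
* `algebraMap_sigmaSqNormLog_eq_sum_embeddings` — **`ι (sigmaSqNormLog W p H z) = Σ_σ Log Σ_p(σ z)`**
  for `z ∈ H^×` with `‖σ z‖ < 1` at every embedding `σ : H →ₐ[ℚ] L`.

## References

* B. Mazur, W. Stein, J. Tate, Doc. Math. Extra Vol. Coates (2006), §2.8 (PDF p. 11 L33–58:
  `ρ^K_cycl = ρ^ℚ_cycl ∘ N_{K/ℚ}`, `h_p(P) = p⁻¹[Σ_{v∣p} log_p N_{K_v/ℚ_p} σ_v(P) − …]`). [MazurSteinTate2006]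
* A. M. Robert, *A Course in p-adic Analysis* (2000), Ch. V §4.5. [Robert2000PadicAnalysis]
* J. Neukirch, *Algebraic Number Theory* (1999), Ch. II (8.1)–(8.2) (`N = ∏_σ σ` over the embeddings
  into `ℚ̄_p`). [NeukirchANT1999]
-/

noncomputable section

open scoped Classical
open PowerSeries Filter NumberField
open scoped Topology
open Literature.NumberTheory.Transcendental Literature.NumberTheory.LocalFields

namespace Literature.NumberTheory.EllipticCurves

variable {p : ℕ} [Fact p.Prime] {L : Type*} [NontriviallyNormedField L] [CharZero L]
  [NormedAlgebra ℚ_[p] L] [IsUltrametricDist L] [CompleteSpace L]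

/-! ### §1 `Log ∘ ι = ι ∘ log_p` and `Log` of products -/

section Log

variable {Log : L → L} (hmul : ∀ x y : L, x ≠ 0 → y ≠ 0 → Log (x * y) = Log x + Log y)
  (hlog : ∀ y : L, ‖1 - y‖ < 1 → Log y = PadicExp.plog y) (hLp : Log (p : L) = 0)

include hmul in
omit [CharZero L] [NormedAlgebra ℚ_[p] L] [IsUltrametricDist L] [CompleteSpace L] in
/-- `Log (∏ aᵢ) = Σ Log aᵢ` for nonzero `aᵢ`. [cite: Robert2000PadicAnalysis, Ch. V §4.5 Proposition] -/
theorem logFun_prod {ι : Type*} (s : Finset ι) {g : ι → L} (hg : ∀ i ∈ s, g i ≠ 0) :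
    Log (∏ i ∈ s, g i) = ∑ i ∈ s, Log (g i) := by
  induction s using Finset.induction_on with
  | empty => rw [Finset.prod_empty, Finset.sum_empty, logFun_one hmul]
  | insert i s hi ih =>
    rw [Finset.prod_insert hi, Finset.sum_insert hi,
      hmul _ _ (hg i (Finset.mem_insert_self i s))
        (Finset.prod_ne_zero_iff.mpr fun j hj => hg j (Finset.mem_insert_of_mem hj)),
      ih fun j hj => hg j (Finset.mem_insert_of_mem hj)]

include hmul hlog hLp in
omit [IsUltrametricDist L] [CompleteSpace L] in
/-- **`Log (ι a) = ι (log_p a)` for `a ∈ ℚ_p^×`**: the restriction of the Iwasawa logarithm of `L`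
to `ℚ_p` is the Iwasawa logarithm of `ℚ_p` (`a = p^v·w`, `w ∈ ℤ_p^×`; `Log p = 0 = log_p p`; on
`w^{p−1} ∈ 1 + pℤ_p` both are the logarithmic series, whose coefficients are rational).
[cite: Robert2000PadicAnalysis, Ch. V §4.5 Theorem (2)] [cite: Iwasawa1972PadicL, §4.4] -/
theorem log_algebraMap_padic {a : ℚ_[p]} (ha : a ≠ 0) :
    Log (algebraMap ℚ_[p] L a) = algebraMap ℚ_[p] L (padicLog p a) := by
  have hprime : p.Prime := Fact.out
  have hp0 : (p : ℚ_[p]) ≠ 0 := by exact_mod_cast hprime.ne_zero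
  have hpL : (p : L) ≠ 0 := by exact_mod_cast hprime.ne_zero
  set ι := algebraMap ℚ_[p] L with hι
  have hιn : ∀ x, ‖ι x‖ = ‖x‖ := fun x => norm_algebraMap' L x
  -- `a = w · p^v`, `‖w‖ = 1`
  set v : ℤ := a.valuation with hv
  set w : ℚ_[p] := a * (p : ℚ_[p]) ^ (-v) with hw
  have hwn : ‖w‖ = 1 := by
    rw [hw, norm_mul, norm_zpow, Padic.norm_p, Padic.norm_eq_zpow_neg_valuation ha, ← hv, inv_zpow',
      neg_neg, ← zpow_add₀ (by exact_mod_cast hprime.ne_zero : (p : ℝ) ≠ 0), neg_add_cancel, zpow_zero]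
  have hw0 : w ≠ 0 := fun h => by rw [h, norm_zero] at hwn; exact zero_ne_one hwn
  have haw : a = w * (p : ℚ_[p]) ^ v := by
    rw [hw, mul_assoc, ← zpow_add₀ hp0, neg_add_cancel, zpow_zero, mul_one]
  -- `Log (ι a) = Log (ι w)`
  have hιp : ι ((p : ℚ_[p]) ^ v) = (p : L) ^ v := by rw [map_zpow₀, map_natCast]
  have h1 : Log (ι a) = Log (ι w) := by
    rw [haw, map_mul, hιp, hmul _ _ ((map_ne_zero ι).mpr hw0) (zpow_ne_zero v hpL),
      logFun_zpow hmul hpL, hLp, mul_zero, add_zero]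
  -- on the principal unit `w^{p-1}`
  set w' : ℤ_[p] := ⟨w, hwn.le⟩ with hw'
  have hw'n : ‖w'‖ = 1 := hwn
  have hunit : ‖w ^ (p - 1) - 1‖ < 1 := PadicInt.norm_pow_sub_one_sub_one_lt_one hw'n
  have hunit' : ‖1 - ι (w ^ (p - 1))‖ < 1 := by
    rw [← norm_neg, neg_sub, ← map_one ι, ← map_sub, hιn]; exact hunit
  have hunitQ : ‖(1 : ℚ_[p]) - w ^ (p - 1)‖ < 1 := by rw [← norm_neg, neg_sub]; exact hunit
  have h2 : ((p - 1 : ℕ) : L) * Log (ι w) = ι (padicLogSeries p (w ^ (p - 1))) := by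
    rw [← logFun_pow hmul ((map_ne_zero ι).mpr hw0), ← map_pow, hlog _ hunit']
    have hmap := plog_map (p := p) (ι : ℚ_[p] →+* L) hιn hunitQ
    rw [← hmap]
    rfl
  -- compare with `log_p a = (p−1)⁻¹ · L(w^{p−1})`
  have hp1 : ((p - 1 : ℕ) : L) ≠ 0 := by
    have : 1 < p := hprime.one_lt
    exact_mod_cast (show p - 1 ≠ 0 by omega)
  have hcast : ((p - 1 : ℕ) : L) = (p : L) - 1 := by
    rw [Nat.cast_sub hprime.one_lt.le, Nat.cast_one]
  have hR : ι (padicLog p a) = ((p : L) - 1)⁻¹ * ι (padicLogSeries p (w ^ (p - 1))) := by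
    rw [padicLog_of_ne_zero ha]
    simp only [map_mul, map_inv₀, map_sub, map_natCast, map_one]
    try rfl
  rw [hcast] at hp1 h2
  rw [h1, hR, ← h2, ← mul_assoc, inv_mul_cancel₀ hp1, one_mul]

end Log

/-! ### §2 The `p`-part of the height as a sum over the embeddings -/

section SigmaNormLog

variable [IsAlgClosed L] (W : WeierstrassCurve ℚ) (H : Type) [Field H] [NumberField H]

omit [IsUltrametricDist L] [CompleteSpace L] [IsAlgClosed L] in
/-- `ι (algebraMap ℚ ℚ_p q) = algebraMap ℚ L q` (there is one ring homomorphism `ℚ → L`). [folklore] -/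
private theorem algebraMap_algebraMap_rat (q : ℚ) :
    algebraMap ℚ_[p] L (algebraMap ℚ ℚ_[p] q) = algebraMap ℚ L q := by
  rw [eq_ratCast, map_ratCast, eq_ratCast]

/-- The SHIFTED series `S = Σ_p/t²` is integral with `S(0) = 1`, and `Σ_p = t²·S`. [cite: Silverman2005DivPoly, §5 Rem. 2] -/
private theorem sigmaShift_facts (V : WeierstrassCurve ℚ_[p]) :
    IsPadicInt (sigmaShift (sigmaShift V.padicSigmaSq)) ∧
      constantCoeff (sigmaShift (sigmaShift V.padicSigmaSq)) = 1 ∧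
      V.padicSigmaSq = X ^ 2 * sigmaShift (sigmaShift V.padicSigmaSq) := by
  obtain ⟨hint, h0, h1, h2⟩ := V.padicSigmaSq_normalised
  have hS_eq : sigmaShift (sigmaShift V.padicSigmaSq) =
      PowerSeries.mk fun n => coeff (n + 2) V.padicSigmaSq := by
    ext n; rw [coeff_sigmaShift, coeff_sigmaShift, coeff_mk]
  refine ⟨by rw [hS_eq]; exact isPadicInt_shift hint 2, ?_, ?_⟩
  · rw [← coeff_zero_eq_constantCoeff_apply, coeff_sigmaShift, coeff_sigmaShift]
    exact h2
  · ext n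
    rw [coeff_X_pow_mul']
    split_ifs with hn
    · rw [coeff_sigmaShift, coeff_sigmaShift, Nat.sub_add_cancel hn]
    · interval_cases n
      · rw [coeff_zero_eq_constantCoeff_apply]; exact h0
      · exact h1

variable {W H} in
/-- **The `p`-part of the cyclotomic height, read in `L`: `ι(sigmaSqNormLog z) = Σ_σ Log Σ_p(σ z)`.**
For `W/ℚ`, a number field `H`, an algebraically closed complete ultrametric normed `ℚ_p`-algebra field
`L` with an Iwasawa logarithm `Log` (homomorphism on `L^×`, the logarithmic series on `1 + 𝔪_L`,
`Log p = 0`), and `z ∈ H^×` with `‖σ z‖ < 1` for every embedding `σ : H → L`: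
`ι (2 log_p N(z) + Σ'ₙ [tⁿ]ℒ_p Tr(zⁿ)) = Σ_σ Log (Σ_p(σ z))`, where `Σ_p(σz) = padicAlgEval L Σ_p (σ z)` —
the decomposition «`log_p Σ_p(τz) = 2 log_p τz + ℒ(τz)` for each of the `[H:ℚ]` embeddings `τ`» of
the docstring of `sigmaSqNormLog`. [cite: MazurSteinTate2006, §2.8 (PDF p. 11 L33–58)]
[cite: NeukirchANT1999, Ch. II (8.2)] -/
theorem algebraMap_sigmaSqNormLog_eq_sum_embeddings {Log : L → L}
    (hmul : ∀ x y : L, x ≠ 0 → y ≠ 0 → Log (x * y) = Log x + Log y)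
    (hlog : ∀ y : L, ‖1 - y‖ < 1 → Log y = PadicExp.plog y) (hLp : Log (p : L) = 0)
    {z : H} (hz0 : z ≠ 0) (hz : ∀ σ : H →ₐ[ℚ] L, ‖σ z‖ < 1) :
    algebraMap ℚ_[p] L (W.sigmaSqNormLog p H z) =
      ∑ σ : H →ₐ[ℚ] L, Log (padicAlgEval L (W.baseChange ℚ_[p]).padicSigmaSq (σ z)) := by
  set ι := algebraMap ℚ_[p] L with hι
  set V := W.baseChange ℚ_[p] with hV
  obtain ⟨hSint, hS0, hSq⟩ := sigmaShift_facts V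
  set S := sigmaShift (sigmaShift V.padicSigmaSq) with hS
  have hιn : ∀ x, ‖ι x‖ = ‖x‖ := fun x => norm_algebraMap' L x
  have hσ0 : ∀ σ : H →ₐ[ℚ] L, σ z ≠ 0 := fun σ => (map_ne_zero σ).mpr hz0
  -- (1) the norm term
  have hN0 : Algebra.norm ℚ z ≠ 0 := Algebra.norm_ne_zero_iff.mpr hz0
  have hnorm : ι (2 * padicLog p (algebraMap ℚ ℚ_[p] (Algebra.norm ℚ z))) =
      ∑ σ : H →ₐ[ℚ] L, 2 * Log (σ z) := by
    rw [map_mul, map_ofNat, ← log_algebraMap_padic hmul hlog hLp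
      ((map_ne_zero _).mpr hN0), algebraMap_algebraMap_rat, Algebra.norm_eq_prod_embeddings ℚ L z,
      logFun_prod hmul _ fun σ _ => hσ0 σ, Finset.mul_sum]
  -- (2) the series term, embedding by embedding: `Log S(σz) = Σₙ ι(ℒₙ) (σz)ⁿ`
  have hℒ0 := V.constantCoeff_padicLogSigmaSqShift
  have hℒ := V.derivative_padicLogSigmaSqShift_mul hS0
  have hper : ∀ σ : H →ₐ[ℚ] L, HasSum (fun n : ℕ => ι (coeff n V.padicLogSigmaSqShift) * (σ z) ^ n)
      (Log (padicAlgEval L S (σ z))) := fun σ =>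
    hasSum_coeff_formalLog_mul_pow_alg hlog hSint hS0 hℒ0 hℒ (hz σ)
  have hsumσ : HasSum (fun n : ℕ => ∑ σ : H →ₐ[ℚ] L, ι (coeff n V.padicLogSigmaSqShift) * (σ z) ^ n)
      (∑ σ : H →ₐ[ℚ] L, Log (padicAlgEval L S (σ z))) :=
    hasSum_sum fun σ _ => hper σ
  -- the same family is `ι` of the `ℚ_p`-family `ℒₙ · Tr(zⁿ)`
  set g : ℕ → ℚ_[p] := fun n =>
    coeff n V.padicLogSigmaSqShift * algebraMap ℚ ℚ_[p] (Algebra.trace ℚ H (z ^ n)) with hg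
  have hgι : ∀ n, ι (g n) = ∑ σ : H →ₐ[ℚ] L, ι (coeff n V.padicLogSigmaSqShift) * (σ z) ^ n := by
    intro n
    rw [hg]
    dsimp only
    rw [map_mul, algebraMap_algebraMap_rat, trace_eq_sum_embeddings L, Finset.mul_sum]
    exact Finset.sum_congr rfl fun σ _ => by rw [map_pow]
  have hιg : HasSum (fun n => ι (g n)) (∑ σ : H →ₐ[ℚ] L, Log (padicAlgEval L S (σ z))) := by
    refine hsumσ.congr_fun fun n => (hgι n)
  -- summability in `ℚ_p` (isometric transfer) and identification of the `tsum`
  have hgs : Summable g := by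
    refine NonarchimedeanAddGroup.summable_of_tendsto_cofinite_zero ?_
    have h := hιg.summable.tendsto_cofinite_zero
    rw [NormedAddGroup.tendsto_nhds_zero] at h ⊢
    intro ε hε
    exact (h ε hε).mono fun n hn => by rwa [hιn] at hn
  have htsum : ι (∑' n, g n) = ∑ σ : H →ₐ[ℚ] L, Log (padicAlgEval L S (σ z)) := by
    have h := hgs.hasSum.map (ι : ℚ_[p] →+* L) (continuous_algebraMap ℚ_[p] L)
    exact h.unique hιg
  -- (3) assemble: `2 Log(σz) + Log S(σz) = Log((σz)² S(σz)) = Log Σ_p(σz)`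
  have hSne : ∀ σ : H →ₐ[ℚ] L, padicAlgEval L S (σ z) ≠ 0 := by
    intro σ h0
    have hA : IsPadicInt (S - 1) := hSint.sub IsPadicInt.one
    have hA0 : constantCoeff (S - 1) = 0 := by rw [map_sub, hS0, map_one, sub_self]
    have hv : ‖padicAlgEval L (S - 1) (σ z)‖ < 1 := norm_padicAlgEval_lt_one hA hA0 (hz σ)
    rw [padicAlgEval_sub hSint IsPadicInt.one (hz σ), padicAlgEval_one, h0, zero_sub, norm_neg,
      norm_one] at hv
    exact lt_irrefl _ hv
  have hX : IsPadicInt (X : ℚ_[p]⟦X⟧) := IsPadicInt.powerSeries_X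
  have hSig : ∀ σ : H →ₐ[ℚ] L,
      padicAlgEval L V.padicSigmaSq (σ z) = (σ z) ^ 2 * padicAlgEval L S (σ z) := fun σ => by
    rw [hSq, padicAlgEval_mul (hX.pow 2) hSint (hz σ), padicAlgEval_pow hX (hz σ), padicAlgEval_X]
  rw [WeierstrassCurve.sigmaSqNormLog_def, map_add, hnorm, ← hV]
  change (∑ σ : H →ₐ[ℚ] L, 2 * Log (σ z)) + ι (∑' n, g n) = _
  rw [htsum, ← Finset.sum_add_distrib]
  refine Finset.sum_congr rfl fun σ _ => ?_
  rw [hSig σ, hmul _ _ (pow_ne_zero 2 (hσ0 σ)) (hSne σ), logFun_pow hmul (hσ0 σ), Nat.cast_ofNat]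

end SigmaNormLog

end Literature.NumberTheory.EllipticCurves

end
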